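import Mathlib

/-!
# Hodge-locus census, THEOREM SM-∞ — the block partial derivatives of `F₀` (all degrees `d`)

certified instances and evidence bearing on the general Hodge conjecture; no claim.

Companion to `HodgeLocusCensusSigmaFamily` (ENGINE B gen 35, record `ENGINEB-g35.md` §1.2): there the gradient bound
`‖∇F₀‖_∞ ≥ 1/2` is proved from the four closed forms of the partial derivatives of the two kinds of blocks of the
Thom–Sebastiani form `F₀ = Σ_j (y_j x_j^{d−1} + y_j^d) + a^{d−1} b + a b^{d−1}`.  This def-free file checks those closed
forms for SYMBOLIC degree: each block is regarded as a one-variable polynomial (Mathlib's `Polynomial.X`) in the variable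
being differentiated, the other variable an arbitrary constant of a commutative ring `R`, and `Polynomial.derivative` is
evaluated.  We write the degree as `e + 3` (`e = d − 3 ≥ 0`; the theorem uses `d ≥ 4`), so that `d − 1 = e + 2`, `d − 2 = e + 1`
and no truncated subtraction occurs.
* `blockXY_partial_x` : `∂/∂x (y x^{d−1} + y^d) = (d−1) x^{d−2} y`;
* `blockXY_partial_y` : `∂/∂y (y x^{d−1} + y^d) = x^{d−1} + d y^{d−1}`;
* `blockAB_partial_a` : `∂/∂a (a^{d−1} b + a b^{d−1}) = b((d−1)a^{d−2} + b^{d−2})`;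
* `blockAB_partial_b` : `∂/∂b (a^{d−1} b + a b^{d−1}) = a(a^{d−2} + (d−1)b^{d−2})`;
* `coupling_partial`  : `∂/∂x (c x^{d−2}) = (d−2) c x^{d−3}` — the coupling monomials `y_j x_{j+1}^{d−2} x_{j+2}`, `y_{k−2} x₀ x_{k−1}^{d−2}`
  differentiated in their high variable (gradient weight `d − 2`, plus `1` from the neighbouring coupling: `M = d − 1`).
-/

namespace Summit.HodgeConjecture.HodgeConjecture.HodgeLocus.Census.SigmaFamilyPartials

open Polynomial

variable {R : Type*} [CommRing R]

/-- `∂/∂x (y x^{e+2} + y^{e+3}) = (e+2) y x^{e+1}` (block `W_j` in `x_j`; `d = e + 3`). -/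
theorem blockXY_partial_x (y : R) (e : ℕ) :
    derivative (C y * X ^ (e + 2) + C (y ^ (e + 3))) = C (((e + 2 : ℕ) : R) * y) * X ^ (e + 1) := by
  simp only [derivative_add, derivative_mul, derivative_C, derivative_X_pow, map_mul, map_natCast]
  have : e + 2 - 1 = e + 1 := by omega
  rw [this]; push_cast; ring

/-- `∂/∂y (y x^{e+2} + y^{e+3}) = x^{e+2} + (e+3) y^{e+2}` (block `W_j` in `y_j`). -/
theorem blockXY_partial_y (x : R) (e : ℕ) :
    derivative (X * C (x ^ (e + 2)) + X ^ (e + 3)) = C (x ^ (e + 2)) + C (((e + 3 : ℕ) : R)) * X ^ (e + 2) := by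
  simp only [derivative_add, derivative_mul, derivative_C, derivative_X, derivative_X_pow, map_natCast]
  have : e + 3 - 1 = e + 2 := by omega
  rw [this]; push_cast; ring

/-- `∂/∂a (a^{e+2} b + a b^{e+2}) = b((e+2) a^{e+1} + b^{e+1})` (block `W′` in `a`). -/
theorem blockAB_partial_a (b : R) (e : ℕ) :
    derivative (X ^ (e + 2) * C b + X * C (b ^ (e + 2)))
      = C b * (C (((e + 2 : ℕ) : R)) * X ^ (e + 1) + C (b ^ (e + 1))) := by
  simp only [derivative_add, derivative_mul, derivative_C, derivative_X, derivative_X_pow, map_natCast]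
  have : e + 2 - 1 = e + 1 := by omega
  rw [this]; push_cast
  simp only [map_pow]
  ring

/-- `∂/∂b (a^{e+2} b + a b^{e+2}) = a(a^{e+1} + (e+2) b^{e+1})` (block `W′` in `b`). -/
theorem blockAB_partial_b (a : R) (e : ℕ) :
    derivative (C (a ^ (e + 2)) * X + C a * X ^ (e + 2))
      = C a * (C (a ^ (e + 1)) + C (((e + 2 : ℕ) : R)) * X ^ (e + 1)) := by
  simp only [derivative_add, derivative_mul, derivative_C, derivative_X, derivative_X_pow, map_natCast]
  have : e + 2 - 1 = e + 1 := by omega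
  rw [this]; push_cast
  simp only [map_pow]
  ring

/-- `∂/∂x (c x^{e+1}) = (e+1) c x^{e}`: a coupling monomial of `x`-degree `d − 2 = e + 1` in its high variable. -/
theorem coupling_partial (c : R) (e : ℕ) :
    derivative (C c * X ^ (e + 1)) = C (((e + 1 : ℕ) : R) * c) * X ^ e := by
  simp only [derivative_mul, derivative_C, derivative_X_pow, map_mul, map_natCast]
  have : e + 1 - 1 = e := by omega
  rw [this]; push_cast; ring

/-- Euler check for the block `W = y x^{e+2} + y^{e+3}`: `x ∂_x W + y ∂_y W = (e+3) W`. -/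
theorem blockXY_euler (x y : R) (e : ℕ) :
    x * (((e + 2 : ℕ) : R) * x ^ (e + 1) * y) + y * (x ^ (e + 2) + ((e + 3 : ℕ) : R) * y ^ (e + 2))
      = ((e + 3 : ℕ) : R) * (y * x ^ (e + 2) + y ^ (e + 3)) := by
  push_cast; ring

/-- Euler check for the block `W′ = a^{e+2} b + a b^{e+2}`: `a ∂_a W′ + b ∂_b W′ = (e+3) W′`. -/
theorem blockAB_euler (a b : R) (e : ℕ) :
    a * (b * (((e + 2 : ℕ) : R) * a ^ (e + 1) + b ^ (e + 1))) + b * (a * (a ^ (e + 1) + ((e + 2 : ℕ) : R) * b ^ (e + 1)))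
      = ((e + 3 : ℕ) : R) * (a ^ (e + 2) * b + a * b ^ (e + 2)) := by
  push_cast; ring

end Summit.HodgeConjecture.HodgeConjecture.HodgeLocus.Census.SigmaFamilyPartials
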